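import Summits.AnomalousDissipation.AnomalousDissipation.Theses.TameRoughRigidity
import Summits.AnomalousDissipation.AnomalousDissipation.Theorems.EnsembleRigidityEnsembleFloorTransfer
import HarnessLib

/-!
# Route TameRoughRigidity — the support item `EnsembleFloorTransfer`

Proof of the route declaration
`Summit.AnomalousDissipation.AnomalousDissipation.Theses.TameRoughRigidity.EnsembleFloorTransfer`
(item stmt-AnomalousDissipation-18617): ENSEMBLE FLOOR ⇒ PATH FLOOR. For `ν > 0` and a smooth
divergence-free mean-zero force `f` on `T³`: if every stationary statistical solution `μ` of
NS_ν(f) with integrable energy and `ensembleEnergy μ ≤ E` has `ensembleDissipation ν μ ≥ ε₀`, then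
every global Leray–Hopf path `u` with an `H`-valued lift `U` (`U t = u t` a.e., `t ≥ 0`) and
`meanEnergy u ≤ E` has `meanDissipation ν u ≥ ε₀`.

The route declaration is the byte-identical route-local copy (route TameRoughRigidity, rev 1 cone
repair) of the parent route's bridge item
`Summit.AnomalousDissipation.AnomalousDissipation.Theses.EnsembleRigidity.EnsembleFloorTransfer`
(item stmt-AnomalousDissipation-15511), which is already proved in
`Theorems/EnsembleRigidityEnsembleFloorTransfer.lean` by
`Summit.AnomalousDissipation.AnomalousDissipation.Theorems.EnsembleFloorTransfer_proof`
(Foias–Manley–Rosa–Temam 2001, Ch. IV §3.1, generalized-limit-valued enstrophy bound (3.3)). The two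
definitions unfold to the same proposition, so the proof is a transport along that definitional
equality; it lives in its own file so that the route file `Theses/TameRoughRigidity.lean` keeps its
small import cone (the statement is a hypothesis `h₆` of the route's deciding theorem `closes`).

## References

* C. Foias, O. Manley, R. Rosa, R. Temam, *Navier–Stokes Equations and Turbulence* (CUP 2001),
  Ch. IV §3.1 Prop. 3.1, Thm. 3.1, (3.3)–(3.4). [FoiasManleyRosaTemam2001]
* C. R. Doering, C. Foias, J. Fluid Mech. 467 (2002), §2. [DoeringFoias2002]
-/

-- `Summit.<Summit>.<Problem>` is the tree's mandated summit-side namespace (CONVENTIONS §2); for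
-- this single-conjunct summit the two coincide, so the duplicate is deliberate.
set_option linter.dupNamespace false

namespace Summit.AnomalousDissipation.AnomalousDissipation.Theorems

/-- **`TameRoughRigidity.EnsembleFloorTransfer`** (item stmt-AnomalousDissipation-18617): for
`ν > 0` and a smooth divergence-free mean-zero force `f` on `T³`, if every stationary statistical
solution of NS_ν(f) with integrable energy and `ensembleEnergy ≤ E` has `ensembleDissipation ≥ ε₀`,
then every global Leray–Hopf path `u` with an `H`-valued lift and `meanEnergy u ≤ E` has
`meanDissipation ν u ≥ ε₀`. The route-local copy of the parent item
`EnsembleRigidity.EnsembleFloorTransfer` (stmt-AnomalousDissipation-15511), concluded by the landed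
`EnsembleFloorTransfer_proof` (the two route declarations are definitionally equal).
[cite: FoiasManleyRosaTemam2001, Ch. IV §3.1 Prop. 3.1, Thm. 3.1, (3.3)–(3.4)] -/
theorem tameRoughRigidity_ensembleFloorTransfer_proof :
    Summit.AnomalousDissipation.AnomalousDissipation.Theses.TameRoughRigidity.EnsembleFloorTransfer := by
  unfold Summit.AnomalousDissipation.AnomalousDissipation.Theses.TameRoughRigidity.EnsembleFloorTransfer
  intro ν E ε₀ f u₀ u U hν hfs hfd hfz hfloor hu hU hE
  exact EnsembleFloorTransfer_proof ν E ε₀ f u₀ u U hν hfs hfd hfz hfloor hu hU hE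

end Summit.AnomalousDissipation.AnomalousDissipation.Theorems
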